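import Mathlib
import Summits.ValiantsHypothesis.ValiantsHypothesis.Theses.FeketeSOS
import Literature.NumberTheory.LFunctions.FeketePolynomial

/-!
# `FeketeSOS.FeketeSOSHard` (stmt-ValiantsHypothesis-3996) — line `Sketch` (euler-multiplicity-tau ⊕ witt-zero-carry)

Lead's working skeleton (prover-line-stmt-ValiantsHypothesis-3996-0, 2026-08-16), reshaped from the planner's
`Cruxes/FeketeSOSHard/SketchIdeator2.lean` (a list of `Prop` first-lemmas) into the registered stub form:

* vocabulary: the Sketch's local `fekete R p` is the tree's `(feketePolynomial p).map (Int.castRingHom R)` (over `ℂ`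
  this is LITERALLY the crux's inlined sum, `map_feketePolynomial_complex`); `pairSparsity A B` and
  `HasGoodReduction p c g` are inlined verbatim (no new definitions);
* `FeketeModPOrder` is not a stub: the inequality `(p-1)/2 ≤ ord₁ F̄_p` is the sibling line's landed
  `FeketeNoSparseSplitCyclic.stub_feketeModPOrder` (copied here as `lfmo_feketeModPOrder` until the farm snapshot builds that module);
* the Sketch's `Composition C : FeketeModPOrder → OrdSparsitySum C → GoodReductionBound C` is PROVED here
  (`goodReductionBound_of_ordSparsitySum`), and `CruxOfBranches` is PROVED here (`FeketeSOSHard_of`).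

THE LINE: split a complex representation `F_p = Σ c_i g_i²` by reduction type at `p`.  GOOD reduction (all
coefficients in a subring `O ⊆ ℂ` mapping to a field `k` of characteristic `p`): push the identity to `k[X]` and reduce
cyclically — `Σ_j Ā_j B̄_j ≡ F̄_p (mod X^p - 1)` with `Ā_j = c̄_j ḡ_j`, `B̄_j = ḡ_j` of degree `< p` on the same supports
(`stub_goodReductionTransfer`); in characteristic `p`, `X^p - 1 = (X-1)^p` and Euler's criterion give
`(X-1)^{(p-1)/2} ∣ Σ_j Ā_j B̄_j ≢ 0 (mod X^p - 1)`, so the order–sparsity inequality for SUMS of sparse products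
(`stub_ordSparsitySum`, conjecture OS) yields the LINEAR bound `(p-1)/2 ≤ C·Σ_j(|Ā_j|+|B̄_j|) ≤ 2C·Σ_i |supp g_i|`.
BAD reduction: the complementary branch (`stub_badReduction`, the Sketch's `BadReductionFeketeSOS` made
rescaling-invariant — see its docstring; intended engine: the companion card witt-zero-carry).  Composition: `δ = min(δ_bad, 1/4)`, `p₀ = max(p_bad, 3, (8(C+1))⁴)`.

STATUS (cycle 1): `stub_ordSparsitySum` is FALSE (socle tiling, TRIAGE-r1-1/2; Lean refutation in
`work/SketchOrdSparsityFalse.lean`); see NOTES.md `## Census` for the reshape analysis.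
-/

namespace Summit.ValiantsHypothesis.ValiantsHypothesis.Theorems.FeketeSOSHardSketch

open Polynomial
open Literature.NumberTheory.LFunctions
open Summit.ValiantsHypothesis.ValiantsHypothesis.Theses

set_option linter.unusedVariables false
-- `Summit.ValiantsHypothesis.ValiantsHypothesis.…` is the tree's mandated single-conjunct layout (Sub = Summit).
set_option linter.dupNamespace false

noncomputable section

/-! ## Local copies of the sibling line's Euler-multiplicity lemmas
(adapted verbatim from `Theorems/FeketeSOSFeketeNoSparseSplitFeketeModPOrder.lean`, renamed `lfmo_*`; that module is
not yet built on the farm snapshot — switch to the import when it is) -/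

section Helpers

variable {K : Type*} [Field K]

/-- The Euler operator `X·d/dX` multiplies the `n`-th coefficient by `n`. [folklore] -/
theorem lfmo_coeff_X_mul_derivative (f : K[X]) (n : ℕ) :
    (X * derivative f).coeff n = f.coeff n * (n : K) := by
  cases n with
  | zero => rw [mul_coeff_zero, coeff_X_zero, zero_mul, Nat.cast_zero, mul_zero]
  | succ n => rw [coeff_X_mul, coeff_derivative, Nat.cast_succ]

/-- The `j`-th iterate of `X·d/dX` multiplies the `n`-th coefficient by `n^j`. [folklore] -/
theorem lfmo_coeff_iterate_XD (f : K[X]) (j n : ℕ) :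
    ((fun g : K[X] => X * derivative g)^[j] f).coeff n = f.coeff n * (n : K) ^ j := by
  induction j with
  | zero => rw [Function.iterate_zero_apply, pow_zero, mul_one]
  | succ j ih =>
    rw [Function.iterate_succ_apply']
    show (X * derivative ((fun g : K[X] => X * derivative g)^[j] f)).coeff n = _
    rw [lfmo_coeff_X_mul_derivative, ih, pow_succ, mul_assoc]

/-- **Order drop**: `j` applications of `X·d/dX` lower the `(X - c)`-adic order of `(X - c)^N` by at
most `j`. [folklore] -/
theorem lfmo_dvd_iterate_XD (c : K) (N j : ℕ) :
    (X - C c) ^ (N - j) ∣ (fun g : K[X] => X * derivative g)^[j] ((X - C c) ^ N) := by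
  induction j with
  | zero => rw [Nat.sub_zero, Function.iterate_zero_apply]
  | succ j ih =>
    rw [Function.iterate_succ_apply', Nat.sub_add_eq]
    exact dvd_mul_of_dvd_right (pow_sub_one_dvd_derivative_of_pow_dvd ih) X

/-- **Euler's criterion in `K`**: `((n|p) : K) = n ^ (p/2)` in a field of characteristic `p`
(Mathlib's `legendreSym.eq_pow` transported along `ZMod p →+* K`). [folklore] -/
theorem lfmo_intCast_legendreSym (p : ℕ) [Fact p.Prime] [CharP K p] (n : ℕ) :
    ((legendreSym p n : ℤ) : K) = (n : K) ^ (p / 2) := by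
  rw [← map_intCast (ZMod.castHom (dvd_refl p) K) (legendreSym p n), legendreSym.eq_pow, map_pow,
    Int.cast_natCast, map_natCast]

/-- **`Σ_{m<p} X^m = (X - 1)^{p-1}`** in characteristic `p` (Frobenius `(X-1)^p = X^p - 1` and the
telescoping `(Σ_{m<p} X^m)(X-1) = X^p - 1`). [folklore] -/
theorem lfmo_geom_sum_eq (p : ℕ) [Fact p.Prime] [CharP K p] :
    (∑ m ∈ Finset.range p, (X : K[X]) ^ m) = (X - C 1) ^ (p - 1) := by
  have hp : p.Prime := Fact.out
  have hfrob : (X - C (1 : K)) ^ p = X ^ p - 1 := by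
    rw [sub_pow_char, ← C_pow, one_pow, C_1]
  apply mul_right_cancel₀ (X_sub_C_ne_zero (1 : K))
  rw [← pow_succ, Nat.sub_add_cancel hp.one_le, hfrob, C_1, geom_sum_mul]

/-- The reduction of `f_p` to characteristic `p` is non-zero (its coefficient of `X` is `(1|p) = 1`).
[folklore] -/
theorem lfmo_map_feketePolynomial_ne_zero (p : ℕ) [Fact p.Prime] :
    (feketePolynomial p).map (Int.castRingHom K) ≠ 0 := fun h => by
  have h1 : ((feketePolynomial p).map (Int.castRingHom K)).coeff 1 = 0 := by rw [h, coeff_zero]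
  rw [coeff_map, coeff_feketePolynomial_of_lt p (Fact.out : p.Prime).one_lt, Nat.cast_one,
    legendreSym.at_one, map_one] at h1
  exact one_ne_zero h1

/-- **`F̄_p = (X·d/dX)^{p/2} (Σ_{m<p} X^m)`** in characteristic `p`, by Euler's criterion coefficientwise.
[folklore] -/
theorem lfmo_map_feketePolynomial_eq (p : ℕ) [Fact p.Prime] [CharP K p] :
    (feketePolynomial p).map (Int.castRingHom K)
      = (fun g : K[X] => X * derivative g)^[p / 2] (∑ m ∈ Finset.range p, (X : K[X]) ^ m) := by
  ext n
  rw [lfmo_coeff_iterate_XD, coeff_map, coeff_feketePolynomial, finsetSum_coeff]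
  simp only [coeff_X_pow, Finset.sum_ite_eq, Finset.mem_range]
  split_ifs
  · rw [eq_intCast, lfmo_intCast_legendreSym, one_mul]
  · rw [map_zero, zero_mul]

end Helpers

/-- **The order of `F̄_p` at `1` is at least `(p-1)/2`** in every field of characteristic `p` (`p` odd).
[folklore] -/
theorem lfmo_feketeModPOrder :
    ∀ (K : Type) [Field K] (p : ℕ) [Fact p.Prime] [CharP K p], p ≠ 2 →
      (p - 1) / 2 ≤ rootMultiplicity (1 : K) ((feketePolynomial p).map (Int.castRingHom K)) := by
  intro K _ p _ _ _
  rw [le_rootMultiplicity_iff (lfmo_map_feketePolynomial_ne_zero p), lfmo_map_feketePolynomial_eq p,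
    lfmo_geom_sum_eq p]
  have h := lfmo_dvd_iterate_XD (1 : K) (p - 1) (p / 2)
  rwa [show p - 1 - p / 2 = (p - 1) / 2 by omega] at h


/-! ## The three registered stubs (S2 closed) -/

/-- **Stub 1 — order–sparsity inequality for sums (conjecture OS, `∃ C, OrdSparsitySum C` of the Sketch).**
Over a field `k` of characteristic `p`, a sum of `r` products of polynomials of degree `< p` that is non-zero
modulo `X^p - 1` vanishes at `X = 1` to order at most `C ·` (support-sum of the `2r` factors). -/
theorem stub_ordSparsitySum :
    ∃ C : ℕ, ∀ (k : Type) [Field k] (p : ℕ) [Fact p.Prime] [CharP k p] (r : ℕ) (A B : Fin r → k[X]) (M : ℕ),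
      (∀ j, (A j).natDegree < p ∧ (B j).natDegree < p) →
      ¬ ((X : k[X]) ^ p - 1 ∣ ∑ j, A j * B j) →
      (X - 1 : k[X]) ^ M ∣ ∑ j, A j * B j →
      M ≤ C * ∑ j, ((A j).support.card + (B j).support.card) := by
  sorry

/-! ### Stub 2 — LANDED (worker W1, p87210, `Theorems/FeketeSOSFeketeSOSHardGoodReductionTransfer.lean`,
namespace `FeketeSOSHardSketch`).  Inlined verbatim below until the farm snapshot builds that module; then replace this
block by `import Summits.ValiantsHypothesis.ValiantsHypothesis.Theorems.FeketeSOSFeketeSOSHardGoodReductionTransfer`. -/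

section Fold

variable {k : Type*} [CommRing k]

/-- The cyclic fold `Σ_{n ∈ supp f} f_n X^{n mod p}` has no more monomials than `f`: its support lies
in the image of `supp f` under `n ↦ n mod p`. -/
theorem grt_card_support_fold_le (f : k[X]) (p : ℕ) :
    (∑ n ∈ f.support, C (f.coeff n) * X ^ (n % p)).support.card ≤ f.support.card := by
  classical
  calc (∑ n ∈ f.support, C (f.coeff n) * X ^ (n % p)).support.card
      ≤ (f.support.image fun n => n % p).card := by
        refine Finset.card_le_card fun m hm => ?_
        rw [mem_support_iff, finsetSum_coeff] at hm
        obtain ⟨n, hn, hne⟩ := Finset.exists_ne_zero_of_sum_ne_zero hm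
        rw [coeff_C_mul, coeff_X_pow] at hne
        refine Finset.mem_image.mpr ⟨n, hn, ?_⟩
        by_contra h
        exact hne (by rw [if_neg (Ne.symm h), mul_zero])
    _ ≤ f.support.card := Finset.card_image_le

/-- The cyclic fold has degree `< p` (for `0 < p`). -/
theorem grt_natDegree_fold_lt (f : k[X]) {p : ℕ} (hp : 0 < p) :
    (∑ n ∈ f.support, C (f.coeff n) * X ^ (n % p)).natDegree < p := by
  refine lt_of_le_of_lt (natDegree_sum_le_of_forall_le (n := p - 1) f.support _ fun n _ => ?_)
    (Nat.sub_lt hp one_pos)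
  refine (natDegree_C_mul_X_pow_le (f.coeff n) (n % p)).trans ?_
  have := Nat.mod_lt n hp
  omega

/-- `X^p - 1 ∣ X^{n mod p} - X^n`. -/
theorem grt_X_pow_sub_one_dvd_X_pow_mod_sub (p n : ℕ) :
    (X : k[X]) ^ p - 1 ∣ X ^ (n % p) - X ^ n := by
  have h : (X : k[X]) ^ n = X ^ (n % p) * (X ^ p) ^ (n / p) := by
    rw [← pow_mul, ← pow_add, Nat.mod_add_div]
  have h2 : (X : k[X]) ^ (n % p) - X ^ n = - (X ^ (n % p) * ((X ^ p) ^ (n / p) - 1 ^ (n / p))) := by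
    rw [h]; ring
  rw [h2, dvd_neg]
  exact Dvd.dvd.mul_left (sub_dvd_pow_sub_pow ((X : k[X]) ^ p) 1 (n / p)) _

/-- The cyclic fold of `f` is congruent to `f` modulo `X^p - 1`. -/
theorem grt_X_pow_sub_one_dvd_fold_sub (f : k[X]) (p : ℕ) :
    (X : k[X]) ^ p - 1 ∣ (∑ n ∈ f.support, C (f.coeff n) * X ^ (n % p)) - f := by
  have h : (∑ n ∈ f.support, C (f.coeff n) * X ^ (n % p)) - f
      = ∑ n ∈ f.support, C (f.coeff n) * (X ^ (n % p) - X ^ n) := by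
    simp only [mul_sub, Finset.sum_sub_distrib, ← as_sum_support_C_mul_X_pow]
  rw [h]
  exact Finset.dvd_sum fun n _ => Dvd.dvd.mul_left (grt_X_pow_sub_one_dvd_X_pow_mod_sub p n) _

/-- The support of `C a * f` lies in the support of `f`. -/
theorem grt_support_C_mul_subset (a : k) (f : k[X]) : (C a * f).support ⊆ f.support := fun n hn => by
  rw [mem_support_iff] at hn ⊢
  rw [coeff_C_mul] at hn
  exact right_ne_zero_of_mul hn

/-- **Assembly modulo `X^p - 1`**: if `Σ_i a_i h_i² = F` and `B_j ≡ h_j (mod X^p - 1)`, then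
`Σ_j (a_j B_j) B_j ≡ F (mod X^p - 1)`. -/
theorem grt_dvd_sum_mul_sub {p s : ℕ} (a : Fin s → k) (h B : Fin s → k[X]) (F : k[X])
    (hrep : ∑ i, C (a i) * h i ^ 2 = F) (hB : ∀ j, (X : k[X]) ^ p - 1 ∣ B j - h j) :
    (X : k[X]) ^ p - 1 ∣ (∑ j, (C (a j) * B j) * B j) - F := by
  rw [← hrep, ← Finset.sum_sub_distrib]
  refine Finset.dvd_sum fun j _ => ?_
  have e : C (a j) * B j * B j - C (a j) * h j ^ 2 = C (a j) * (B j + h j) * (B j - h j) := by ring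
  rw [e]
  exact Dvd.dvd.mul_left (hB j) _

end Fold

/-- **Good-reduction transfer (the vehicle).**  A complex representation `Σ_i c_i g_i² = F_p` all of
whose coefficients lie in a subring `O ⊆ ℂ` that maps to a field `k` of characteristic `p` yields, in `k[X]`,
a CYCLIC representation `X^p - 1 ∣ Σ_j A_j B_j - F̄_p` by `s` products of polynomials of degree `< p` with
`|supp A_j|, |supp B_j| ≤ |supp g_j|` (push the identity along `O → k`, then reduce exponents mod `p`). -/
theorem stub_goodReductionTransfer :
    ∀ (p : ℕ) [Fact p.Prime] (s : ℕ) (c : Fin s → ℂ) (g : Fin s → ℂ[X]),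
      (∃ (O : Subring ℂ) (k : Type) (_ : Field k) (_ : CharP k p) (_ : O →+* k),
        (∀ i, c i ∈ O) ∧ (∀ i n, (g i).coeff n ∈ O)) →
      (∑ i, C (c i) * g i ^ 2) = (feketePolynomial p).map (Int.castRingHom ℂ) →
      ∃ (k : Type) (_ : Field k) (_ : CharP k p) (A B : Fin s → k[X]),
        (∀ j, (A j).natDegree < p ∧ (B j).natDegree < p) ∧
        (∀ j, (A j).support.card ≤ (g j).support.card ∧ (B j).support.card ≤ (g j).support.card) ∧
        ((X : k[X]) ^ p - 1 ∣ (∑ j, A j * B j) - (feketePolynomial p).map (Int.castRingHom k)) := by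
  intro p _ s c g hgood hrep
  obtain ⟨O, k, hk, hchar, φ, hc, hg⟩ := hgood
  classical
  have hp0 : 0 < p := (Fact.out : p.Prime).pos
  -- (1) lift the weights and the polynomials to `O` and `O[X]`
  obtain ⟨c', hc'⟩ : ∃ c' : Fin s → O, ∀ i, (c' i : ℂ) = c i := ⟨fun i => ⟨c i, hc i⟩, fun i => rfl⟩
  have hcoeffs : ∀ i, (↑(g i).coeffs : Set ℂ) ⊆ O := fun i a ha => by
    obtain ⟨n, -, rfl⟩ := Polynomial.mem_coeffs_iff.mp ha
    exact hg i n
  obtain ⟨g', hg'map, hg'supp⟩ :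
      ∃ g' : Fin s → O[X], (∀ i, (g' i).map O.subtype = g i) ∧ (∀ i, (g' i).support = (g i).support) :=
    ⟨fun i => (g i).toSubring O (hcoeffs i), fun i => map_toSubring _ _ _,
      fun i => support_toSubring _ _ _⟩
  -- the Fekete polynomial pushed along `ℤ → R → S` is the Fekete polynomial pushed along `ℤ → S`
  have hFmap : ∀ (R S : Type) [CommRing R] [CommRing S] (f : R →+* S),
      ((feketePolynomial p).map (Int.castRingHom R)).map f
        = (feketePolynomial p).map (Int.castRingHom S) := fun R S _ _ f => by
    rw [Polynomial.map_map, RingHom.ext_int (f.comp (Int.castRingHom R)) (Int.castRingHom S)]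
  -- (2) the identity in `O[X]` (injectivity of `map O.subtype`)
  have hrepO : (∑ i, C (c' i) * g' i ^ 2) = (feketePolynomial p).map (Int.castRingHom O) := by
    apply Polynomial.map_injective O.subtype O.subtype_injective
    rw [hFmap O ℂ O.subtype, ← hrep, Polynomial.map_sum]
    refine Finset.sum_congr rfl fun i _ => ?_
    rw [Polynomial.map_mul, Polynomial.map_pow, map_C, hg'map i, Subring.subtype_apply, hc' i]
  -- (3) push along `φ`
  obtain ⟨h, hh⟩ : ∃ h : Fin s → k[X], ∀ i, h i = (g' i).map φ := ⟨_, fun _ => rfl⟩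
  have hrepk : (∑ i, C (φ (c' i)) * h i ^ 2) = (feketePolynomial p).map (Int.castRingHom k) := by
    rw [← hFmap O k φ, ← hrepO, Polynomial.map_sum]
    refine Finset.sum_congr rfl fun i _ => ?_
    rw [Polynomial.map_mul, Polynomial.map_pow, map_C, hh i]
  have hhsupp : ∀ i, (h i).support.card ≤ (g i).support.card := fun i => by
    rw [← hg'supp i, hh i]
    exact Finset.card_le_card (support_map_subset _ _)
  -- (4) fold cyclically and (5) assemble
  obtain ⟨B, hB⟩ : ∃ B : Fin s → k[X], ∀ j, B j = ∑ n ∈ (h j).support, C ((h j).coeff n) * X ^ (n % p) :=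
    ⟨_, fun _ => rfl⟩
  have hBdeg : ∀ j, (B j).natDegree < p := fun j => by
    rw [hB j]; exact grt_natDegree_fold_lt (h j) hp0
  have hBsupp : ∀ j, (B j).support.card ≤ (g j).support.card := fun j => by
    rw [hB j]; exact (grt_card_support_fold_le (h j) p).trans (hhsupp j)
  have hBdvd : ∀ j, (X : k[X]) ^ p - 1 ∣ B j - h j := fun j => by
    rw [hB j]; exact grt_X_pow_sub_one_dvd_fold_sub (h j) p
  refine ⟨k, hk, hchar, fun j => C (φ (c' j)) * B j, B, fun j => ⟨?_, hBdeg j⟩,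
    fun j => ⟨?_, hBsupp j⟩, ?_⟩
  · exact lt_of_le_of_lt (natDegree_C_mul_le _ _) (hBdeg j)
  · exact (Finset.card_le_card (grt_support_C_mul_subset _ _)).trans (hBsupp j)
  · exact grt_dvd_sum_mul_sub (fun j => φ (c' j)) h B _ hrepk hBdvd

/-- **Stub 3 — the bad-reduction branch, rescaling-invariant form of the Sketch's `BadReductionFeketeSOS`.**
Representations `F_p = Σ_i c_i g_i²` such that NO rescaling `(c_i, g_i) ↦ (c_i / a_i², a_i·g_i)` (`a_i ≠ 0`: the same
squares `c_i g_i²`, supports and degrees) has good reduction at `p` — i.e. the representation is `p`-adically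
CANCELLING at every place of `ℂ` above `p` — obey the crux's bound.  Intended engine: witt-zero-carry (top-layer
syzygy telescoping ⇒ zero carry ⇒ OS with `2r` products one layer down).  RESHAPED at registration: as typed in the
Sketch (hypothesis `¬ HasGoodReduction p c g` for the given scaling only) the branch is crux-complete, because
spoiling one square `(c₀, g₀) ↦ (1/p², p·√c₀·g₀)` puts `1/p` into every coefficient ring and makes EVERY representation
"bad" without changing supports (NOTES.md `## Census`). -/
theorem stub_badReduction :
    ∃ δ : ℝ, 0 < δ ∧ ∃ p₀ : ℕ, ∀ (p : ℕ) [Fact p.Prime], p₀ ≤ p →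
      ∀ (s : ℕ) (c : Fin s → ℂ) (g : Fin s → ℂ[X]), (s : ℝ) ≤ (p : ℝ) ^ δ →
        (∀ a : Fin s → ℂ, (∀ i, a i ≠ 0) →
          ¬ (∃ (O : Subring ℂ) (k : Type) (_ : Field k) (_ : CharP k p) (_ : O →+* k),
              (∀ i, c i / a i ^ 2 ∈ O) ∧ (∀ i n, (C (a i) * g i).coeff n ∈ O))) →
        (∀ i, (g i).natDegree ≤ p ^ 2) →
        (∑ i, C (c i) * g i ^ 2) = (feketePolynomial p).map (Int.castRingHom ℂ) →
        (p : ℝ) ^ (1 / 2 + δ) ≤ ∑ i, ((g i).support.card : ℝ) := by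
  sorry

/-! ## Proved: the Sketch's `Composition` (Euler multiplicity + OS ⇒ linear good-reduction bound) -/

/-- In characteristic `p`, `X^p - 1 = (X - 1)^p`. -/
theorem X_pow_sub_one_eq (k : Type) [Field k] (p : ℕ) [Fact p.Prime] [CharP k p] :
    (X : k[X]) ^ p - 1 = (X - 1) ^ p := by
  rw [sub_pow_char, one_pow]

/-- `F̄_p` is not divisible by `X^p - 1` (it is non-zero of degree `< p`). -/
theorem not_X_pow_sub_one_dvd_fekete (k : Type) [Field k] (p : ℕ) [Fact p.Prime] :
    ¬ ((X : k[X]) ^ p - 1 ∣ (feketePolynomial p).map (Int.castRingHom k)) := by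
  intro h
  have hF0 : (feketePolynomial p).map (Int.castRingHom k) ≠ 0 := lfmo_map_feketePolynomial_ne_zero p
  have hdeg := natDegree_le_of_dvd h hF0
  have h1 : ((X : k[X]) ^ p - 1).natDegree = p := by rw [← C_1, natDegree_X_pow_sub_C]
  have h2 : ((feketePolynomial p).map (Int.castRingHom k)).natDegree < p := by
    refine lt_of_le_of_lt natDegree_map_le ?_
    rw [natDegree_feketePolynomial]
    exact Nat.sub_lt (Fact.out : p.Prime).pos one_pos
  omega

/-- **`Composition` of the Sketch, proved**: OS with constant `C` gives the linear good-reduction bound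
`(p-1)/2 ≤ C · Σ_j (|supp A_j| + |supp B_j|)` for every cyclic char-`p` representation of `F̄_p` by products of
polynomials of degree `< p` (`p` odd). -/
theorem goodReductionBound_of_ordSparsitySum (κ : ℕ)
    (hOS : ∀ (k : Type) [Field k] (p : ℕ) [Fact p.Prime] [CharP k p] (r : ℕ) (A B : Fin r → k[X]) (M : ℕ),
      (∀ j, (A j).natDegree < p ∧ (B j).natDegree < p) →
      ¬ ((X : k[X]) ^ p - 1 ∣ ∑ j, A j * B j) →
      (X - 1 : k[X]) ^ M ∣ ∑ j, A j * B j →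
      M ≤ κ * ∑ j, ((A j).support.card + (B j).support.card))
    (k : Type) [Field k] (p : ℕ) [Fact p.Prime] [CharP k p] (hp2 : p ≠ 2)
    (r : ℕ) (A B : Fin r → k[X]) (hdeg : ∀ j, (A j).natDegree < p ∧ (B j).natDegree < p)
    (hdiv : (X : k[X]) ^ p - 1 ∣ (∑ j, A j * B j) - (feketePolynomial p).map (Int.castRingHom k)) :
    (p - 1) / 2 ≤ κ * ∑ j, ((A j).support.card + (B j).support.card) := by
  set F : k[X] := (feketePolynomial p).map (Int.castRingHom k) with hF
  set G : k[X] := ∑ j, A j * B j with hG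
  -- Euler: (X - 1)^((p-1)/2) ∣ F̄_p
  have hordF : (X - 1 : k[X]) ^ ((p - 1) / 2) ∣ F := by
    have h1 := lfmo_feketeModPOrder k p hp2
    have h2 : (X - C (1 : k)) ^ rootMultiplicity (1 : k) F ∣ F := pow_rootMultiplicity_dvd F 1
    rw [C_1] at h2
    exact (pow_dvd_pow _ h1).trans h2
  -- (X - 1)^((p-1)/2) ∣ X^p - 1 ∣ G - F
  have hordGF : (X - 1 : k[X]) ^ ((p - 1) / 2) ∣ G - F := by
    refine dvd_trans ?_ hdiv
    rw [X_pow_sub_one_eq k p]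
    exact pow_dvd_pow _ (by omega)
  have hordG : (X - 1 : k[X]) ^ ((p - 1) / 2) ∣ G := by
    have := dvd_add hordGF hordF
    rwa [sub_add_cancel] at this
  -- G is non-zero mod X^p - 1 (else F̄_p would be)
  have hnot : ¬ ((X : k[X]) ^ p - 1 ∣ G) := by
    intro h
    apply not_X_pow_sub_one_dvd_fekete k p
    have := dvd_sub h hdiv
    rwa [sub_sub_cancel] at this
  exact hOS k p r A B ((p - 1) / 2) hdeg hnot hordG

/-! ## Rescaling a weighted square -/

/-- `c·g² = (c/a²)·(a g)²` for `a ≠ 0`. -/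
theorem rescale_sq {a : ℂ} (ha : a ≠ 0) (c : ℂ) (g : ℂ[X]) :
    C (c / a ^ 2) * (C a * g) ^ 2 = C c * g ^ 2 := by
  rw [mul_pow, ← C_pow, ← mul_assoc, ← C_mul, div_mul_cancel₀ c (pow_ne_zero 2 ha)]

/-- Rescaling by `a ≠ 0` does not change the support. -/
theorem support_C_mul_eq {a : ℂ} (ha : a ≠ 0) (g : ℂ[X]) : (C a * g).support = g.support := by
  ext n
  simp only [mem_support_iff, coeff_C_mul, ne_eq, mul_eq_zero, ha, false_or]

/-! ## The composition: the crux from the three stubs -/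

/-- Real-exponent bookkeeping: if `(8 κ)^4 ≤ p` then `8 κ · p^{3/4} ≤ p`. -/
theorem rpow_three_quarters_le (κ : ℕ) (p : ℕ) (hp : (8 * κ) ^ 4 ≤ p) :
    8 * (κ : ℝ) * (p : ℝ) ^ (3 / 4 : ℝ) ≤ p := by
  have hp0 : (0 : ℝ) ≤ (p : ℝ) := Nat.cast_nonneg p
  have h8 : (0 : ℝ) ≤ 8 * (κ : ℝ) := by positivity
  set y : ℝ := (p : ℝ) ^ (1 / 4 : ℝ) with hy
  have hy0 : 0 ≤ y := Real.rpow_nonneg hp0 _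
  have hy4 : y ^ (4 : ℕ) = p := by
    rw [hy, ← Real.rpow_natCast, ← Real.rpow_mul hp0]; norm_num
  have hroot : 8 * (κ : ℝ) ≤ y := by
    have h1 : (8 * (κ : ℝ)) ^ (4 : ℕ) ≤ y ^ (4 : ℕ) := by
      rw [hy4]; exact_mod_cast hp
    exact (pow_le_pow_iff_left₀ h8 hy0 (by norm_num)).mp h1
  have hsplit : (p : ℝ) ^ (3 / 4 : ℝ) * y = p := by
    rcases eq_or_lt_of_le hp0 with h | h
    · rw [← h]; simp
    · rw [hy, ← Real.rpow_add h]; norm_num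
  have hnn : 0 ≤ (p : ℝ) ^ (3 / 4 : ℝ) := Real.rpow_nonneg hp0 _
  calc 8 * (κ : ℝ) * (p : ℝ) ^ (3 / 4 : ℝ) = (p : ℝ) ^ (3 / 4 : ℝ) * (8 * (κ : ℝ)) := by ring
    _ ≤ (p : ℝ) ^ (3 / 4 : ℝ) * y := mul_le_mul_of_nonneg_left hroot hnn
    _ = p := hsplit

/-- **The crux from the line** (`CruxOfBranches` of the Sketch, proved): `δ = min(δ_bad, 1/4)`,
`p₀ = max(p_bad, 3, (8(κ+1))⁴)`. -/
theorem FeketeSOSHard_of : FeketeSOS.FeketeSOSHard := by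
  classical
  obtain ⟨κ, hOS⟩ := stub_ordSparsitySum
  obtain ⟨δb, hδb, pb, hbad⟩ := stub_badReduction
  -- OS with constant C + 1 (so that the constant is positive)
  set κ₁ : ℕ := κ + 1 with hκ₁
  have hκ₁1 : 1 ≤ κ₁ := by omega
  have hOS₁ : ∀ (k : Type) [Field k] (p : ℕ) [Fact p.Prime] [CharP k p] (r : ℕ) (A B : Fin r → k[X]) (M : ℕ),
      (∀ j, (A j).natDegree < p ∧ (B j).natDegree < p) →
      ¬ ((X : k[X]) ^ p - 1 ∣ ∑ j, A j * B j) →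
      (X - 1 : k[X]) ^ M ∣ ∑ j, A j * B j →
      M ≤ κ₁ * ∑ j, ((A j).support.card + (B j).support.card) := by
    intro k _ p _ _ r A B M h1 h2 h3
    exact (hOS k p r A B M h1 h2 h3).trans (Nat.mul_le_mul_right _ (Nat.le_succ κ))
  refine ⟨min δb (1 / 4), lt_min hδb (by norm_num), max pb (max 3 ((8 * κ₁) ^ 4)), ?_⟩
  intro p _ hp s c g hs hdeg hrep
  have hprime : p.Prime := Fact.out
  have hpb : pb ≤ p := le_trans (le_max_left _ _) hp
  have hp3 : 3 ≤ p := le_trans (le_trans (le_max_left _ _) (le_max_right _ _)) hp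
  have hpC : (8 * κ₁) ^ 4 ≤ p := le_trans (le_trans (le_max_right _ _) (le_max_right _ _)) hp
  have hp2 : p ≠ 2 := by omega
  have hp1 : (1 : ℝ) ≤ (p : ℝ) := by exact_mod_cast hprime.one_lt.le
  have hp0 : (0 : ℝ) < (p : ℝ) := by linarith
  have hrep' : (∑ i, C (c i) * g i ^ 2) = (feketePolynomial p).map (Int.castRingHom ℂ) := by
    rw [map_feketePolynomial_complex]; exact hrep
  -- the exponent `1/2 + min δb (1/4)` is at most `3/4` and at most `1/2 + δb`
  have hexp1 : (1 / 2 : ℝ) + min δb (1 / 4) ≤ 3 / 4 := by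
    have := min_le_right δb (1 / 4); linarith
  have hexp2 : (1 / 2 : ℝ) + min δb (1 / 4) ≤ 1 / 2 + δb := by
    have := min_le_left δb (1 / 4); linarith
  by_cases hgood : ∃ a : Fin s → ℂ, (∀ i, a i ≠ 0) ∧
      ∃ (O : Subring ℂ) (k : Type) (_ : Field k) (_ : CharP k p) (_ : O →+* k),
        (∀ i, c i / a i ^ 2 ∈ O) ∧ (∀ i n, (C (a i) * g i).coeff n ∈ O)
  · -- GOOD reduction (after a rescaling): transfer the rescaled representation, then the linear bound
    obtain ⟨a, ha, hgood'⟩ := hgood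
    have hrep'' : (∑ i, C (c i / a i ^ 2) * (C (a i) * g i) ^ 2) =
        (feketePolynomial p).map (Int.castRingHom ℂ) := by
      rw [← hrep']
      exact Finset.sum_congr rfl fun i _ => rescale_sq (ha i) (c i) (g i)
    obtain ⟨k, instF, instC, A, B, hdegk, hsupp, hdivk⟩ :=
      stub_goodReductionTransfer p s (fun i => c i / a i ^ 2) (fun i => C (a i) * g i) hgood' hrep''
    have hbound : (p - 1) / 2 ≤ κ₁ * ∑ j, ((A j).support.card + (B j).support.card) :=
      goodReductionBound_of_ordSparsitySum κ₁ hOS₁ k p hp2 s A B hdegk hdivk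
    have hsum : ∑ j, ((A j).support.card + (B j).support.card) ≤ 2 * ∑ j, (g j).support.card := by
      rw [Finset.mul_sum]
      exact Finset.sum_le_sum fun j _ => by
        have := hsupp j
        rw [support_C_mul_eq (ha j)] at this
        omega
    set S : ℕ := ∑ j, (g j).support.card with hS
    have hodd : p % 2 = 1 := Nat.odd_iff.mp (hprime.odd_of_ne_two hp2)
    have hnat : p - 1 ≤ 4 * κ₁ * S := by
      have h := hbound.trans (Nat.mul_le_mul_left κ₁ hsum)
      have h' : 2 * ((p - 1) / 2) = p - 1 := by omega
      nlinarith
    -- reals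
    have hcastS : (∑ i, ((g i).support.card : ℝ)) = (S : ℝ) := by rw [hS]; push_cast; rfl
    rw [hcastS]
    have hreal : (p : ℝ) - 1 ≤ 4 * (κ₁ : ℝ) * (S : ℝ) := by
      have h1 : ((p - 1 : ℕ) : ℝ) ≤ ((4 * κ₁ * S : ℕ) : ℝ) := by exact_mod_cast hnat
      have h2 : ((p - 1 : ℕ) : ℝ) = (p : ℝ) - 1 := by
        rw [Nat.cast_sub hprime.one_lt.le]; simp
      rw [h2] at h1; push_cast at h1; exact h1
    have hκ₁r : (1 : ℝ) ≤ (κ₁ : ℝ) := by exact_mod_cast hκ₁1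
    have hp3r : (3 : ℝ) ≤ (p : ℝ) := by exact_mod_cast hp3
    have hS8 : (p : ℝ) ≤ 8 * (κ₁ : ℝ) * (S : ℝ) := by nlinarith
    have h34 : 8 * (κ₁ : ℝ) * (p : ℝ) ^ (3 / 4 : ℝ) ≤ p := rpow_three_quarters_le κ₁ p hpC
    have hmono : (p : ℝ) ^ (1 / 2 + min δb (1 / 4)) ≤ (p : ℝ) ^ (3 / 4 : ℝ) :=
      Real.rpow_le_rpow_of_exponent_le hp1 hexp1
    have hpos : (0 : ℝ) < 8 * (κ₁ : ℝ) := by positivity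
    have hfin : (p : ℝ) ^ (3 / 4 : ℝ) ≤ (S : ℝ) := le_of_mul_le_mul_left (h34.trans hS8) hpos
    exact hmono.trans hfin
  · -- BAD reduction: the branch stub applies with its own exponent
    have hsb : (s : ℝ) ≤ (p : ℝ) ^ δb :=
      hs.trans (Real.rpow_le_rpow_of_exponent_le hp1 (min_le_left _ _))
    have hb := hbad p hpb s c g hsb (fun a ha hex => hgood ⟨a, ha, hex⟩) hdeg hrep'
    exact (Real.rpow_le_rpow_of_exponent_le hp1 hexp2).trans hb

/-- The crux, by its conventional closing name. -/
theorem FeketeSOSHard_proof : FeketeSOS.FeketeSOSHard := FeketeSOSHard_of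

end

end Summit.ValiantsHypothesis.ValiantsHypothesis.Theorems.FeketeSOSHardSketch
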